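import Summits.BirchSwinnertonDyer.Rank1Residual.Supersingular.KuriharaTwistRoundingSchema
import HarnessLib

/-!
# Kurihara numbers from twisted `L`-values — the record schema AT `p = 3` (odd `p`, `ν(n) < p`):
# the `p = 3` twin of `KuriharaTwistSchema.lean`, with the bins-to-`δ̃` identity re-decided

Cell `b2b-bsdres` (BSD rank `≤ 1` residual classes), team n1011 (N10/N11: the additive `p = 3` block),
seat p09 GEN 3, OWNERS row T-TW3 = the rider of ROUTE-1 §19.6 R1-18 (planner r1 GEN 7): the `p = 3`
port of the cell's twisted-`L`-value Kurihara engines needs a kernel record schema, and the tree's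
`TwistRecord.consistent` (`Supersingular/KuriharaTwistSchema.lean`, x10b gen 8) has `5 ≤ r.p` baked in.
Topic file under `Summits/BirchSwinnertonDyer/Rank1Residual/Supersingular/` (next to its parent; the
schema is class-agnostic — its first consumers at `3` are the N11 LOWER@3 rows of class X4); namespace
`Summit.BirchSwinnertonDyer.Rank1Residual.Supersingular.KuriharaTwist` (that of `TwistRecord`).

HONEST FRAMING (run/shared/lean/b2b/bsd-rank1-residual/, verbatim in every file): the goal of the
cell is to DELETE the COMBINATION-SHAPED residual classes of the Birch–Swinnerton-Dyer formula for
ALL analytic-rank `≤ 1` elliptic curves over `ℚ` — "full BSD formula for every rank `≤ 1` curve in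
class `C`" assembled STRICTLY from published theorems — so that the rank-`≤ 1` remainder becomes
exactly the CONSTRUCTION-SHAPED classes, which are TYPED (missing-input `Prop`s), NOT attempted.
This is not "finishing BSD".  Team n1011 is a RESEARCH ROUTE; this file is a DATA SCHEMA with a
decidable recheck (no named fact, no definition of a mathematical notion, nothing asserted about any
elliptic curve, nothing booked; the N11 mark of RESIDUAL-MAP §I is unchanged).  The consumers-in-waiting
of `p = 3` records are CONDITIONAL on an ANNOUNCED preprint (C.-H. Kim, app. R. Pollack,
arXiv:2505.09121v1, flag `Kim2025-preprint`: `Kim2025.…_of_towerSurj_OPEN` at level 1, the level-`k`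
records of `Additive/X4KimLargeImageLevelKRankOne.lean`), exactly as the `p ≥ 5` records are
conditional on nothing but Kim 2026 Thm. 1.8 (6); a record enters those consumers only through a
`KuriharaCertificates.Record.Claim`-style EVIDENCE hypothesis, never as a fact.

## What is re-decided: the bins-to-`δ̃` identity at `p = 3` (and at depth `k`)

Notation of the parent file: level `n = ℓ₁⋯ℓ_ν` (square-free), plus symbol `x⁺{∞, a/n}` (PARI
`msfromell` normalisation), discrete logarithms `L_ℓ = log_{η_ℓ} : (ℤ/ℓ)ˣ → ℤ/(ℓ−1) → ℤ/q`,
`m(a) = Σ_ℓ L_ℓ(a) (mod q)`, sum-bins `C_j = Σ_{a ∈ (ℤ/n)ˣ, m(a) ≡ j (q)} x⁺{∞, a/n}` (`0 ≤ j < q`),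
binomial moments `e_t = Σ_j binom(j, t)·C_j`, and `c_∞·δ̃_n = Σ_a x⁺{∞, a/n}·Π_ℓ L_ℓ(a) (mod q)`.
Here `q = p^k` and the primes are LEVEL-`k` KOLYVAGIN PRIMES: `ℓ ∤ N`, `ℓ ≡ 1 (mod q)`,
`a_ℓ(E) ≡ ℓ + 1 ≡ 2 (mod q)` (Kim 2025 `𝒩_k`; `k = 1` is Kim 2026 §1.2.2 `𝒩₁`).

**Claim.** If `p` is odd, `ν < p`, and every `x⁺{∞, b/m}` (`m ∣ n`) is `p`-integral, then
`e_t ≡ 0 (mod q)` for `t < ν` and `e_ν ≡ c_∞·δ̃_n (mod q)`.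

*Proof.* (1) For `t < p` the polynomial `binom(X, t) = X(X−1)⋯(X−t+1)/t!` has coefficients in
`ℤ_(p)`, so `binom(m(a), t) ≡ binom(M(a), t) (mod q)` for the INTEGER `M(a) = Σ_ℓ L_ℓ(a)` (any lifts),
and `e_t ≡ Σ_a x⁺{∞,a/n}·binom(M(a), t)` is `Σ_a x⁺·P_t(L_{ℓ₁}(a), …, L_{ℓ_ν}(a))` for a polynomial `P_t`
of degree `t` over `ℤ_(p)`.  (2) KEY LEMMA: for a level `m` with `ν(m)` primes and a monomial
`w = Π_ℓ L_ℓ^{k_ℓ}` (`ℓ ∣ m`) of degree `≤ ν(m)` that OMITS some prime `ℓ₀ ∣ m`,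
`S_m(w) := Σ_{b ∈ (ℤ/m)ˣ} x⁺{∞, b/m}·w(b) ≡ 0 (mod q)`.  Indeed, with `m' = m/ℓ₀` and the Hecke
distribution relation `Σ_{b ≡ c (m'), ℓ₀ ∤ b} x⁺{∞, b/m} = a_{ℓ₀}·x⁺{∞, c/m'} − x⁺{∞, ℓ₀c/m'} − x⁺{∞, ℓ₀⁻¹c/m'}`
(`T_{ℓ₀} = Σ_i [1 i; 0 ℓ₀] + [ℓ₀ 0; 0 1]` on the eigen-symbol, `ℓ₀ ∤ Nm'`; the `b` divisible by `ℓ₀` is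
removed by the last term), `S_m(w) = a_{ℓ₀}·S_{m'}(w) − S_{m'}(w⁺ + w⁻)` with `w^±(c) = w(ℓ₀^{±1}c) =
Π_ℓ (L_ℓ(c) ± u_ℓ)^{k_ℓ}`, `u_ℓ = L_ℓ(ℓ₀)` (each `L_ℓ`, `ℓ ∣ m'`, is a homomorphism); expanding,
`w⁺ + w⁻ = 2w + 2·Σ_j κ_j L^j` over exponents `j < k` with `|k| − |j| ≥ 2` even (`κ_j ∈ ℤ[u]`), so
`S_m(w) = (a_{ℓ₀} − 2)·S_{m'}(w) − 2 Σ_j κ_j S_{m'}(L^j)` with `deg L^j ≤ deg w − 2 ≤ ν(m) − 2 < ν(m')`: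
each `L^j` omits a prime of `m'` and has degree `≤ ν(m')`, and `a_{ℓ₀} − 2 ≡ 0 (mod q)`; induct on `ν(m)`
(base `ν(m) = 1`: `w` is constant and `S_{ℓ₀}(1) = (a_{ℓ₀} − 2)·x⁺{∞, 0}`).  [The degree bound is needed:
`S_{ℓ₀ℓ₁}(L₁³) ≡ −6u²·c_∞δ̃_{ℓ₁}`, not `0` in general; but `deg P_t = t ≤ ν` below.]  (3) For `t < ν`
every monomial of `P_t` has degree `< ν`, hence omits a prime: `e_t ≡ 0`.  For `t = ν` the only monomial
of `P_ν` using all `ν` primes is `Π_ℓ L_ℓ`, whose coefficient in `binom(ΣL, ν)` is the multinomial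
`ν!/ν! = 1`; every other monomial has degree `≤ ν` and omits a prime; hence
`e_ν ≡ Σ_a x⁺·Π_ℓ L_ℓ(a) = c_∞·δ̃_n`. ∎

CONSEQUENCES (the decision). (a) The parent's recheck — structure congruences `e_t ≡ 0 (t < ν)` and
`δ̃_n ≡ c_∞⁻¹·D⁻¹·e_ν (mod p)` — is VALID VERBATIM at `p = 3` for `ν ≤ 2`, i.e. for every level the
N11 instrument can reach (ROUTE-1 §19.3: single primes and pairs; the `ν = 3` levels of the 73 DEF≥2 rows
are out of reach by cost anyway).  The only change is the guard: `3 ≤ p` AND `ν < p` (the parent's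
`5 ≤ p` left `ν < p` implicit: its records have `ν ≤ 3`).  (b) It is valid at EVERY DEPTH `k` with
SUM-binning modulo `3^k` (`q − 1 = 8` primitive diagonal twists at `k = 2`): no imprimitive twists and no
vector bins are needed for `ν ≤ 2` — recorded for R1-18's engine design; the depth-`k` record type is the
sibling file `KuriharaTwistSchemaLevelK.lean`.  (c) OUT OF SCOPE, and rejected by the guard: `ν ≥ p`
(at `p = 3`: `6·L₁L₂L₃` is not recoverable from power sums of `m` mod `3` — vector binning would be
needed), and levels containing a BAD prime `ℓ ∥ N` with `a_ℓ = −1 ≡ 2 (mod 3)` (the Kim–Pollack App. §8.1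
counting convention C* of cells/n1011/PREDICTIONS-E2-AT3.md): there `U_ℓ` replaces `T_ℓ`, the relation
loses its `ℓ⁻¹`-term, and `e_{ν−1}` picks up `c_∞·δ̃_{n/ℓ}` — such levels are not Kim's `𝒩_k` and must not
be entered as twist records.  (d) `p`-integrality of all `x⁺{∞, b/m}`: `2·c·#E(ℚ)_tors·x⁺ ∈ ℤ` (Manin;
parent `KuriharaTwistRoundingSchema.lean`), so it holds when `p ∤ c·#E(ℚ)_tors` — automatic on the N11 rows
(`ρ̄_{E,3}` surjective ⇒ no rational `3`-torsion; optimal curve ⇒ `c = 1`); a record violating it shows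
`p ∣ D` and is rejected.

## Design

No new structure: the `p = 3` records ARE `TwistRecord`s (same fields, same generated-file shape); this
file adds the predicates `TwistRecord.consistentOdd` (= `consistent` with `5 ≤ p` replaced by
`3 ≤ p ∧ #primes < p`, every other conjunct byte-identical, same `moment` / `deltaRecomputed`),
`TwistRecord.nonvanishingOdd`, `CertifiedOddL` (decidable; generated theorems
`certL3_<class>_<label> : CertifiedOddL […] := by decide`), the bridges `consistent → consistentOdd`
(given `ν < p`) and back (given `5 ≤ p`), and the unpacking lemmas.  ROUNDING CERTIFICATES need no twin:
`RoundingCert.valid` / `RoundingCert.certifies` (`KuriharaTwistRoundingSchema.lean`) join on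
`(label, p, n, den, bins)` and never mention `consistent`, so they certify a `p = 3` record verbatim
(`certifiesOdd_iff` below is `Iff.rfl`-level bookkeeping for the generated files).  Samples: exact
`msfromell` plus-symbol tables at `p = 3` (kit job j126913, this seat; engine = libpari 2.17 `msfromell` +
`mseval` via cypari2, exact rational bins in Python; cross-checks: the lane's convention pin `37a1 @ 11`
reproduces `KuriharaCertificates.certified_sample`'s `δ̃ = 8`, and `19215t1 @ 3`, `n = 19·97` reproduces
team engine 2's `δ^{min}_{1843} ≡ 1` (p08, kit j122130; `δ^{min} = δ^{x}/g`, `g = 1/2`) as `δ̃ ≡ 2`).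
Validation sweep (kit j127106, this seat): 44 level readings at `p = 3` on `19215t1` (28 levels, two of them
also at `q = 9`) and `22077e1` (`c_∞ = 2`; 10 levels incl. Kim–Pollack's `139·151`) — structure congruences
and `e_ν ≡ c_∞·D·δ̃` hold on 44/44, and the 42 values team engine 2 also computed agree 42/42 (same sign).

References: parent files `KuriharaTwistSchema.lean`, `KuriharaTwistRoundingSchema.lean` (x10b gen 8/9) and
their references (Kim AJM 148 = arXiv:2203.12159 §1.4.3 [Kim2022StructureSelmer]; Mazur–Tate–Teitelbaum
1986 §8; Wiersema–Wuthrich 2022 §2); C.-H. Kim (app. R. Pollack), arXiv:2505.09121v1 §1.1.2 (`𝒩_k`),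
App. §8.1 [Kim2025RefinedTNC, PREPRINT]; cells/n1011/ROUTE-1.md §19 (r1 GEN 7); lane CONVENTIONS.md §3–4
(run/shared/lean/speedrun/kurihara/); seat NOTES.md (n1011-p09 GEN 3).
-/

namespace Summit.BirchSwinnertonDyer.Rank1Residual.Supersingular.KuriharaTwist

/-- Internal consistency of a twist record AT AN ODD PRIME `p ≥ 3` WITH `ν(n) < p` (decidable,
`Bool`-valued): the conjuncts of `TwistRecord.consistent` verbatim — five a-invariants; `n = ∏ primes > 1`
with `primes` duplicate-free and non-empty, `#roots = #primes`, every `ℓ ≡ 1 (mod p)`;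
`components ∈ {1, 2}`; exactly `p` bins; `p ∤ D`, `D ≥ 1`; `deltaModP < p`; the structure congruences
`e_t ≡ 0 (mod p)` for `t < ν`; the recomputation `deltaRecomputed = deltaModP` — except that the guard
`5 ≤ p` is replaced by `3 ≤ p` together with `#primes < p`, the honest range of the bins-to-`δ̃` identity
(module docstring).  (Primality of `p`, `ℓ`, primitivity of the roots, `a_ℓ ≡ 2 (mod p)` and `ℓ ∤ N` are NOT
checked here, as in the parent.) [folklore] -/
def TwistRecord.consistentOdd (r : TwistRecord) : Bool :=
  (r.ainvs.length == 5) &&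
  (r.primes.foldl (· * ·) 1 == r.n) && (1 < r.n) && r.primes.Nodup && (0 < r.primes.length) &&
  (r.roots.length == r.primes.length) && r.primes.all (fun ℓ => ℓ % r.p == 1) && (3 ≤ r.p) &&
  (r.primes.length < r.p) &&
  (r.components == 1 || r.components == 2) &&
  (r.bins.length == r.p) && (r.den % r.p != 0) && (0 < r.den) && (r.deltaModP < r.p) &&
  (List.range r.primes.length).all (fun t => r.moment t % (r.p : ℤ) == 0) &&
  (r.deltaRecomputed == r.deltaModP)

/-- A twist record is an ODD-`p` NON-VANISHING CERTIFICATE when it is `consistentOdd` and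
`deltaModP ≠ 0`, i.e. it records `δ̃_n ≢ 0 (mod p)`. [folklore] -/
def TwistRecord.nonvanishingOdd (r : TwistRecord) : Bool := r.consistentOdd && (0 < r.deltaModP)

/-- A list of twist records is `CertifiedOddL` when every one of them is an odd-`p` non-vanishing
certificate; this is the statement of each generated per-curve theorem
`certL3_<class>_<label> : CertifiedOddL [ … ]` of the `p = 3` record files, proved by `decide`. [folklore] -/
def CertifiedOddL (rs : List TwistRecord) : Prop := rs.all TwistRecord.nonvanishingOdd = true

/-- `CertifiedOddL rs` is decidable (a `Bool` equation). [folklore] -/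
instance CertifiedOddL.instDecidable (rs : List TwistRecord) : Decidable (CertifiedOddL rs) :=
  inferInstanceAs (Decidable (rs.all TwistRecord.nonvanishingOdd = true))

/-! ### Bridges with the `p ≥ 5` predicates of the parent file -/

/-- A `consistent` record (parent predicate, `5 ≤ p`) with `ν < p` is `consistentOdd`: the two
predicates differ only in the guard. [folklore] -/
theorem TwistRecord.consistentOdd_of_consistent {r : TwistRecord} (h : r.consistent = true)
    (hν : r.primes.length < r.p) : r.consistentOdd = true := by
  unfold TwistRecord.consistent at h
  unfold TwistRecord.consistentOdd
  simp only [Bool.and_eq_true] at h ⊢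
  obtain ⟨⟨⟨⟨⟨⟨⟨⟨⟨⟨⟨⟨⟨⟨h1, h2⟩, h3⟩, h4⟩, h5⟩, h6⟩, h7⟩, h8⟩, h9⟩, h10⟩, h11⟩, h12⟩, h13⟩, h14⟩, h15⟩ := h
  have h8' : decide (3 ≤ r.p) = true := by
    rw [decide_eq_true_eq] at h8 ⊢; omega
  exact ⟨⟨⟨⟨⟨⟨⟨⟨⟨⟨⟨⟨⟨⟨⟨h1, h2⟩, h3⟩, h4⟩, h5⟩, h6⟩, h7⟩, h8'⟩, decide_eq_true_eq.mpr hν⟩, h9⟩, h10⟩,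
    h11⟩, h12⟩, h13⟩, h14⟩, h15⟩

/-- Conversely a `consistentOdd` record with `5 ≤ p` is `consistent` in the parent's sense. [folklore] -/
theorem TwistRecord.consistent_of_consistentOdd {r : TwistRecord} (h : r.consistentOdd = true)
    (h5 : 5 ≤ r.p) : r.consistent = true := by
  unfold TwistRecord.consistentOdd at h
  unfold TwistRecord.consistent
  simp only [Bool.and_eq_true] at h ⊢
  obtain ⟨⟨⟨⟨⟨⟨⟨⟨⟨⟨⟨⟨⟨⟨⟨h1, h2⟩, h3⟩, h4⟩, h5'⟩, h6⟩, h7⟩, _⟩, _⟩, h9⟩, h10⟩, h11⟩, h12⟩, h13⟩, h14⟩,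
    h15⟩ := h
  exact ⟨⟨⟨⟨⟨⟨⟨⟨⟨⟨⟨⟨⟨⟨h1, h2⟩, h3⟩, h4⟩, h5'⟩, h6⟩, h7⟩, decide_eq_true_eq.mpr h5⟩, h9⟩, h10⟩, h11⟩,
    h12⟩, h13⟩, h14⟩, h15⟩

/-- The guard of a `consistentOdd` record: `3 ≤ p` and `ν = #primes < p`. [folklore] -/
theorem TwistRecord.three_le_and_length_lt_of_consistentOdd {r : TwistRecord}
    (h : r.consistentOdd = true) : 3 ≤ r.p ∧ r.primes.length < r.p := by
  unfold TwistRecord.consistentOdd at h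
  simp only [Bool.and_eq_true, decide_eq_true_eq] at h
  exact ⟨h.1.1.1.1.1.1.1.1.2, h.1.1.1.1.1.1.1.2⟩

/-- `nonvanishing` (parent) with `ν < p` gives `nonvanishingOdd`. [folklore] -/
theorem TwistRecord.nonvanishingOdd_of_nonvanishing {r : TwistRecord} (h : r.nonvanishing = true)
    (hν : r.primes.length < r.p) : r.nonvanishingOdd = true := by
  simp only [TwistRecord.nonvanishing, TwistRecord.nonvanishingOdd, Bool.and_eq_true] at h ⊢
  exact ⟨TwistRecord.consistentOdd_of_consistent h.1 hν, h.2⟩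

/-- `CertifiedL` (parent, `p ≥ 5`) lists all of whose levels have `ν < p` are `CertifiedOddL`. [folklore] -/
theorem certifiedOddL_of_certifiedL {rs : List TwistRecord} (h : CertifiedL rs)
    (hν : ∀ r ∈ rs, r.primes.length < r.p) : CertifiedOddL rs :=
  List.all_eq_true.2 fun r hr => TwistRecord.nonvanishingOdd_of_nonvanishing (h.nonvanishing_of_mem hr) (hν r hr)

/-! ### Unpacking -/

/-- Unpacking `CertifiedOddL`: every listed record is an odd-`p` non-vanishing certificate. [folklore] -/
theorem CertifiedOddL.nonvanishingOdd_of_mem {rs : List TwistRecord} (h : CertifiedOddL rs)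
    {r : TwistRecord} (hr : r ∈ rs) : r.nonvanishingOdd = true :=
  List.all_eq_true.1 h r hr

/-- Unpacking `CertifiedOddL`: every listed record is `consistentOdd` (its structure congruences hold and
the kernel's recomputation of `δ̃_n mod p` from the bins equals `deltaModP`). [folklore] -/
theorem CertifiedOddL.consistentOdd_of_mem {rs : List TwistRecord} (h : CertifiedOddL rs)
    {r : TwistRecord} (hr : r ∈ rs) : r.consistentOdd = true := by
  have := h.nonvanishingOdd_of_mem hr
  simp only [TwistRecord.nonvanishingOdd, Bool.and_eq_true] at this
  exact this.1

/-- Unpacking `CertifiedOddL`: every listed record has `0 < deltaModP`. [folklore] -/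
theorem CertifiedOddL.deltaModP_pos_of_mem {rs : List TwistRecord} (h : CertifiedOddL rs)
    {r : TwistRecord} (hr : r ∈ rs) : 0 < r.deltaModP := by
  have := h.nonvanishingOdd_of_mem hr
  simp only [TwistRecord.nonvanishingOdd, Bool.and_eq_true, decide_eq_true_eq] at this
  exact this.2

/-- Unpacking `CertifiedOddL`: every listed record has `3 ≤ p` and `ν < p`. [folklore] -/
theorem CertifiedOddL.three_le_and_length_lt_of_mem {rs : List TwistRecord} (h : CertifiedOddL rs)
    {r : TwistRecord} (hr : r ∈ rs) : 3 ≤ r.p ∧ r.primes.length < r.p :=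
  TwistRecord.three_le_and_length_lt_of_consistentOdd (h.consistentOdd_of_mem hr)

/-- `CertifiedOddL` of a `cons` is the head's certificate together with `CertifiedOddL` of the tail.
[folklore] -/
theorem CertifiedOddL.cons_iff (r : TwistRecord) (rs : List TwistRecord) :
    CertifiedOddL (r :: rs) ↔ r.nonvanishingOdd = true ∧ CertifiedOddL rs := by
  simp [CertifiedOddL, List.all_cons]

/-- `CertifiedOddL` of a concatenation is `CertifiedOddL` of both parts. [folklore] -/
theorem CertifiedOddL.append_iff (rs rs' : List TwistRecord) :
    CertifiedOddL (rs ++ rs') ↔ CertifiedOddL rs ∧ CertifiedOddL rs' := by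
  simp [CertifiedOddL, List.all_append]

/-- The empty list is certified (vacuously). [folklore] -/
theorem CertifiedOddL.nil : CertifiedOddL [] := by decide

/-- ROUNDING CERTIFICATES need no twin: `RoundingCert.certifies c r` is the certificate's validity together
with the field join `(label, p, n, den, bins)`; it does not mention `consistent`, so it applies to a
`p = 3` twist record verbatim. [folklore] -/
theorem RoundingCert.certifies_iff (c : RoundingCert) (r : TwistRecord) :
    c.certifies r = true ↔ c.valid = true ∧ c.label = r.label ∧ c.p = r.p ∧ c.n = r.n ∧ c.den = r.den ∧
      c.bins = r.bins := by
  simp only [RoundingCert.certifies, Bool.and_eq_true, beq_iff_eq, and_assoc]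

/-! ### Samples at `p = 3` (exact `msfromell` tables, kit j126913) and regression tests -/

/-- SAMPLE (and regression test of the recheck at `p = 3`, `ν = 2`): `19215t1` (N11 LOWER@3 row of
Kim–Pollack App. §8.1.1: X4 at `3`, `r = 0`, `#Ш_an = 81`), `n = 1843 = 19·97` (GOOD Kolyvagin primes:
`a₁₉ = 8`, `a₉₇ = −1`, both `≡ ℓ + 1 ≡ 2 (mod 3)`; `Ẽ(𝔽_ℓ)[3]` cyclic at both), `η = (2, 5)`, `c_∞ = 1`
(`Δ < 0`): the exact `msfromell` table (1728 symbols, kit j126913, libpari 2.17 via cypari2; `x⁺{∞,0} = 162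
= L(E,1)/ω₁`) has bins `D·C = (−1760, −2312, −1760)` at `D = 2`; `e₀ = e₁ = −5832 = −2⁶·3⁶·… ≡ 0`,
`e₂ = −1760 ≡ 1`, `δ̃ ≡ 1·2⁻¹ ≡ 2 (mod 3)` — NON-VANISHING, = the direct sum `Σ x⁺·L₁₉L₉₇ = −1781584 ≡ 2`
and = team engine 2's `δ^{min}_{1843} ≡ 1` (p08 kit j122130; `δ^{min} = δ̃·c_∞/g`, `g = 1/2`).  The kernel
re-derives `δ̃ ≡ 2` below. [cite: Kim2022StructureSelmer, §1.4.3 (PDF p. 7)] -/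
theorem certifiedOddL_sample : CertifiedOddL [
  { label := "19215t1", ainvs := [0, 0, 1, -10107597, -12660392115], conductor := 19215, p := 3, n := 1843,
    primes := [19, 97], roots := [2, 5], components := 1, rank := 0, reduction := "additive",
    den := 2, bins := [-1760, -2312, -1760], deltaModP := 2,
    evidence := ["kit j126913 (n1011-p09 GEN 3): msfromell exact table, 1728 symbols, sym sha256 in job outputs",
      "direct sum x*L19*L97 = -1781584 = 2 mod 3", "p08 engine-2 j122130: delta_min(1843) = 1, g = 1/2"] } ] := by
  decide

/-- A VANISHING level is a consistent record but NOT a certificate: `19215t1 @ 3`, `n = 19` (`ν = 1`,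
`a₁₉ = 8`, `η₁₉ = 2`; exact table of 18 symbols, kit j126913): bins `D·C = (680, 680, 584)` at `D = 2`,
`e₀ = 1944 ≡ 0`, `e₁ = 1848 ≡ 0`, so `δ̃₁₉ ≡ 0 (mod 3)` (= the direct sum `Σ x⁺·L₁₉ = 8019 ≡ 0`; = team
engine 2's `δ₁₉ = 0`, p08 kit j122130): `consistentOdd` holds — the kernel recomputes `0` — and
`nonvanishingOdd` fails.  (On a rank-`0` row every `ν = 1` level vanishes; the certificate lives at
`ν = 2`, previous theorem.) [folklore] -/
theorem consistentOdd_vanishing_sample :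
    ({ label := "19215t1", ainvs := [0, 0, 1, -10107597, -12660392115], conductor := 19215, p := 3, n := 19,
       primes := [19], roots := [2], components := 1, rank := 0, reduction := "additive",
       den := 2, bins := [680, 680, 584], deltaModP := 0,
       evidence := ["kit j126913: msfromell exact table, 18 symbols", "p08 engine-2 j122130: delta(19) = 0"] }
      : TwistRecord).consistentOdd = true ∧
    ({ label := "19215t1", ainvs := [0, 0, 1, -10107597, -12660392115], conductor := 19215, p := 3, n := 19,
       primes := [19], roots := [2], components := 1, rank := 0, reduction := "additive",
       den := 2, bins := [680, 680, 584], deltaModP := 0, evidence := [] } : TwistRecord).nonvanishingOdd = false := by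
  decide

/-- The parent's `p = 5` sample (`43314b1 @ 5`, `n = 41·251`, `ν = 2 < 5`) is `CertifiedOddL` as well —
obtained here THROUGH THE BRIDGE `certifiedOddL_of_certifiedL` from `certifiedL_sample` (the side
condition `ν < p` decided on the literal). [folklore] -/
theorem certifiedOddL_sample_five : CertifiedOddL [
  { label := "43314b1", ainvs := [1, 1, 0, -2916550, -1916874476], conductor := 43314, p := 5, n := 10291,
    primes := [41, 251], roots := [6, 6], components := 2, rank := 0, reduction := "good-supersingular",
    den := 1, bins := [2134, -2968, 2134, -650, -650], deltaModP := 2,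
    evidence := ["impl1 j102415 = impl2 j102669 = impl3 j107960 (bins exact match)"] } ] :=
  certifiedOddL_of_certifiedL certifiedL_sample (by decide)

/-- Tampering is caught: the `p = 3` sample with `deltaModP` changed from `2` to `1` is NOT certified
(the kernel recomputation from the bins gives `2`). [folklore] -/
theorem not_certifiedOddL_tampered : ¬ CertifiedOddL [
  { label := "19215t1", ainvs := [0, 0, 1, -10107597, -12660392115], conductor := 19215, p := 3, n := 1843,
    primes := [19, 97], roots := [2, 5], components := 1, rank := 0, reduction := "additive",
    den := 2, bins := [-1760, -2312, -1760], deltaModP := 1, evidence := [] } ] := by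
  decide

/-- A corrupted bin is caught by the STRUCTURE congruences: changing `D·C₁` of the sample from `−2312`
to `−2311` breaks `e₁ ≡ 0 (mod 3)` (and `e₀ ≡ 0`), so the record is not certified whatever `deltaModP`
says. [folklore] -/
theorem not_certifiedOddL_corrupted_bin : ¬ CertifiedOddL [
  { label := "19215t1", ainvs := [0, 0, 1, -10107597, -12660392115], conductor := 19215, p := 3, n := 1843,
    primes := [19, 97], roots := [2, 5], components := 1, rank := 0, reduction := "additive",
    den := 2, bins := [-1760, -2311, -1760], deltaModP := 2, evidence := [] } ] := by
  decide

/-- The guard `ν < p` is enforced: a `p = 3` record with THREE primes is rejected whatever its bins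
(here a fabricated level `7·13·19` with zero bins — NOT data), because the bins-to-`δ̃` identity is not
available for `ν ≥ p` (module docstring, (c)). [folklore] -/
theorem not_certifiedOddL_three_primes : ¬ CertifiedOddL [
  { label := "none", ainvs := [0, 0, 0, 0, 0], conductor := 1, p := 3, n := 1729,
    primes := [7, 13, 19], roots := [3, 2, 2], components := 1, rank := 0, reduction := "none",
    den := 1, bins := [0, 0, 0], deltaModP := 1, evidence := ["fabricated shape test, not data"] } ] := by
  decide

end Summit.BirchSwinnertonDyer.Rank1Residual.Supersingular.KuriharaTwist
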